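import Summits.RiemannHypothesis.RiemannHypothesis.Theorems.SoloInformedWindowedZerosLaw
import Literature.NumberTheory.LFunctions.TaoLogElliottProp24
import HarnessLib

/-!
# RH + anti-clustering of the zeros ⟹ the double-exponential lower law (solo-informed T68)

Write `Q` for Weil's quadratic form (`weilQuadratic`) and `ĝ = weilMellin g`. The tree has the
UPPER size law `ε(a) ≤ exp(-c e^{2a})` for the ground energy on the window `[-a, a]` (T2) and,
under RH, the conditional LOWER law T67 (`weilQuadratic_re_ge_of_zeros_near_every_height`): if
`K` pairwise `d`-separated ordinates of zeros lie within `V` of every point below the explicit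
spectral ceiling `exp(C₀ a e^{a})`, then `Re Q(g) ≥ min(1, (e^{-C₀ae^{a}}/4K)² (d/4V)^{2(K-1)})`.

This file feeds T67 from a WINDOWED ANTI-CLUSTERING HYPOTHESIS on the zeros of `ζ`,

  (AC*)  every window `[t, t + V]` with `t ≥ t*` and `(log t)^n ≤ V ≤ t` contains at least
         `c · V · log V` ordinates `γ` of zeros `ζ(½ + iγ) = 0`, pairwise `≥ e^{-V}` apart

(`c > 0`, `n ≥ 1`, `t*` fixed; at the top scale `V = t` this is the order of Selberg's theorem, at
the bottom scale it asks that the `≍ V log log t` DISTINCT ordinates which the RH bound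
`m(γ) ≪ log γ / log log γ` guarantees in such a window be `e^{-V}`-separated), and proves

* `weilQuadratic_re_ge_exp_neg_exp_of_anticlustering` — **RH + (AC*) ⟹ ∃ A, every unit Weil test
  `g` on `[-a, a]`, `a ≥ 1`, has `Re Q(g) ≥ exp(-exp(A a))`.**

With T2 this is the DOUBLE-EXPONENTIAL LAW `2a - O(1) ≤ log log (1/ε(a)) ≤ A a` under RH + (AC*);
with the zero information available unconditionally-under-RH in the tree (Selberg's dyadic blocks
only) the lower law is triple-exponential (T62), and T64/T66 explain why: the lower law is the
inverse of the windowed count of SEPARATED zeros.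

Proof: for a height `|t| < e^{Y}`, `Y = C₀ a e^{a}`, put `W = Y + 4n² + |t*| + e^{19a/c} + a`,
`V = W^n`, `t₁ = max(|t|, V)`; then `log t₁ ≤ W` (either `log t₁ = n log W ≤ W` as `W ≥ 4n²`, or
`log t₁ ≤ log e^{Y} ≤ W`), so `(log t₁)^n ≤ V ≤ t₁` and (AC*) gives `≥ cV log V ≥ 19Va ≥ K`
separated ordinates in `[t₁, t₁ + V] ⊂ B(|t|, 2V)`, reflected through `0` when `t < 0`
(`zeros_near_every_height_of_windows`); T67 with radius `2V`, `d = e^{-V}`,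
`K = ⌈(log 2 + 6Va + a + Y)/log 2⌉` gives `Re Q ≥ exp(-496 a V²) ≥ exp(-exp(A a))`.

References: Weil's criterion and the explicit formula [cite: Bombieri2000Weil, §4]; Selberg's
spacing of critical zeros [cite: Radziwill2012, Lemma 5]; multiplicity under RH
[cite: Titchmarsh1986, Theorem 14.13].
-/

open Complex Set MeasureTheory
open Literature.NumberTheory.LFunctions
open scoped Real

namespace Summit.RiemannHypothesis.RiemannHypothesis.Theorems

/-- `n · log W ≤ W` once `W ≥ 4n²` (`n ≥ 1`). -/
theorem natCast_mul_log_le {n : ℕ} {W : ℝ} (hn : 1 ≤ n) (hW : 4 * (n : ℝ) ^ 2 ≤ W) :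
    (n : ℝ) * Real.log W ≤ W := by
  have hn1 : (1 : ℝ) ≤ n := by exact_mod_cast hn
  have hW0 : 0 < W := by nlinarith
  have hs0 : 0 < Real.sqrt W := Real.sqrt_pos.2 hW0
  have hlog : Real.log W ≤ 2 * Real.sqrt W := by
    have h1 := Real.log_le_sub_one_of_pos hs0
    rw [Real.log_sqrt hW0.le] at h1
    linarith
  have h2n : 2 * (n : ℝ) ≤ Real.sqrt W := by
    have h : Real.sqrt ((2 * n) ^ 2) ≤ Real.sqrt W := Real.sqrt_le_sqrt (by nlinarith)
    rwa [Real.sqrt_sq (by positivity)] at h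
  calc (n : ℝ) * Real.log W ≤ n * (2 * Real.sqrt W) :=
        mul_le_mul_of_nonneg_left hlog (by positivity)
    _ = (2 * n) * Real.sqrt W := by ring
    _ ≤ Real.sqrt W * Real.sqrt W := mul_le_mul_of_nonneg_right h2n hs0.le
    _ = W := Real.mul_self_sqrt hW0.le

/-- Conjugation symmetry of the critical zeros: `ζ(½ + iγ) = 0 ⟹ ζ(½ - iγ) = 0` (Mathlib
`riemannZeta_conj`). -/
theorem riemannZeta_half_add_neg_mul_I {γ : ℝ} (h : riemannZeta (1 / 2 + γ * I) = 0) :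
    riemannZeta (1 / 2 + ((-γ : ℝ) : ℂ) * I) = 0 := by
  have hc : (starRingEnd ℂ) (1 / 2 + (γ : ℂ) * I) = 1 / 2 + ((-γ : ℝ) : ℂ) * I := by
    apply Complex.ext <;> simp
  rw [← hc, riemannZeta_conj, h, map_zero]

/-- From a window `[t₁, t₁ + V]` sitting above a height `u` (`u ≤ t₁ ≤ u + V`, `0 < V ≤ t₁`) to
the ball of radius `2V` about `u`: its ordinates are non-zero and within `2V` of `u`. -/
theorem zeros_ball_of_window {t₁ V u : ℝ} (hut : u ≤ t₁) (ht₁ : t₁ ≤ u + V)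
    (hVt : V ≤ t₁) (hV : 0 < V) (S : Finset ℝ)
    (hS : ∀ γ ∈ S, t₁ ≤ γ ∧ γ ≤ t₁ + V ∧ riemannZeta (1 / 2 + γ * I) = 0) :
    ∀ γ ∈ S, γ ≠ 0 ∧ |γ - u| ≤ 2 * V ∧ riemannZeta (1 / 2 + γ * I) = 0 := by
  intro γ hγ
  obtain ⟨h1, h2, h3⟩ := hS γ hγ
  refine ⟨?_, ?_, h3⟩
  · intro h0
    rw [h0] at h1
    linarith
  · rw [abs_of_nonneg (by linarith)]
    linarith

/-- Reflecting a node set through `0` (`γ ↦ -γ`): zeros go to zeros (conjugation), separation and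
cardinality are kept, and the ball about `u` goes to the ball about `-u`. -/
theorem zeros_ball_reflect {u R d : ℝ} (S : Finset ℝ)
    (hS : ∀ γ ∈ S, γ ≠ 0 ∧ |γ - u| ≤ R ∧ riemannZeta (1 / 2 + γ * I) = 0)
    (hsep : ∀ γ ∈ S, ∀ γ' ∈ S, γ ≠ γ' → d ≤ |γ - γ'|) :
    (∀ γ ∈ S.image (fun x : ℝ ↦ -x), γ ≠ 0 ∧ |γ - (-u)| ≤ R ∧ riemannZeta (1 / 2 + γ * I) = 0) ∧
    (∀ γ ∈ S.image (fun x : ℝ ↦ -x), ∀ γ' ∈ S.image (fun x : ℝ ↦ -x),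
      γ ≠ γ' → d ≤ |γ - γ'|) ∧
    (S.image (fun x : ℝ ↦ -x)).card = S.card := by
  refine ⟨?_, ?_, Finset.card_image_of_injective _ neg_injective⟩
  · intro γ hγ
    obtain ⟨x, hx, rfl⟩ := Finset.mem_image.1 hγ
    obtain ⟨h1, h2, h3⟩ := hS x hx
    refine ⟨neg_ne_zero.2 h1, ?_, riemannZeta_half_add_neg_mul_I h3⟩
    calc |-x - -u| = |x - u| := by rw [show -x - -u = -(x - u) by ring, abs_neg]
      _ ≤ R := h2
  · intro γ hγ γ' hγ' hne
    obtain ⟨x, hx, rfl⟩ := Finset.mem_image.1 hγ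
    obtain ⟨y, hy, rfl⟩ := Finset.mem_image.1 hγ'
    have hxy : x ≠ y := fun h ↦ hne (by rw [h])
    calc d ≤ |x - y| := hsep x hx y hy hxy
      _ = |-x - -y| := by rw [show -x - -y = -(x - y) by ring, abs_neg]

/-- **(AC*) ⟹ the ball hypothesis of T67.** If every window `[t, t + V]` with `t ≥ t*`,
`(log t)^n ≤ V ≤ t` holds `≥ c V log V` ordinates pairwise `≥ e^{-V}` apart, then for
`W ≥ max(1, 4n², t*, log X)` and `K ≤ c W^n log W^n`: within `2W^n` of EVERY `t ∈ (-X, X)` there are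
`≥ K` non-zero ordinates of zeros, pairwise `≥ exp(-W^n)` apart. -/
theorem zeros_near_every_height_of_windows {c tstar : ℝ} {n : ℕ} (hn : 1 ≤ n)
    (hAC : ∀ t V : ℝ, tstar ≤ t → Real.log t ^ n ≤ V → V ≤ t → ∃ S : Finset ℝ,
      (∀ γ ∈ S, t ≤ γ ∧ γ ≤ t + V ∧ riemannZeta (1 / 2 + γ * I) = 0) ∧
      (∀ γ ∈ S, ∀ γ' ∈ S, γ ≠ γ' → Real.exp (-V) ≤ |γ - γ'|) ∧ c * V * Real.log V ≤ S.card)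
    {W X : ℝ} (hW1 : 1 ≤ W) (hWn : 4 * (n : ℝ) ^ 2 ≤ W) (hWt : tstar ≤ W) (hX : Real.log X ≤ W)
    {K : ℕ} (hK : (K : ℝ) ≤ c * W ^ n * Real.log (W ^ n)) :
    ∀ t : ℝ, |t| < X → ∃ S : Finset ℝ,
      (∀ γ ∈ S, γ ≠ 0 ∧ |γ - t| ≤ 2 * W ^ n ∧ riemannZeta (1 / 2 + γ * I) = 0) ∧
      (∀ γ ∈ S, ∀ γ' ∈ S, γ ≠ γ' → Real.exp (-W ^ n) ≤ |γ - γ'|) ∧ K ≤ S.card := by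
  intro t ht
  have hWV : W ≤ W ^ n := le_self_pow₀ hW1 (by omega)
  have hV1 : 1 ≤ W ^ n := hW1.trans hWV
  obtain ⟨t₁, ht₁⟩ : ∃ t₁ : ℝ, t₁ = max |t| (W ^ n) := ⟨_, rfl⟩
  have ht₁u : |t| ≤ t₁ := ht₁ ▸ le_max_left _ _
  have ht₁V : W ^ n ≤ t₁ := ht₁ ▸ le_max_right _ _
  have ht₁le : t₁ ≤ |t| + W ^ n := by
    rw [ht₁]
    exact max_le (by linarith) (by linarith [abs_nonneg t])
  have hlog : Real.log t₁ ≤ W := by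
    rcases le_or_gt |t| (W ^ n) with h | h
    · rw [ht₁, max_eq_right h, Real.log_pow]
      exact natCast_mul_log_le hn hWn
    · rw [ht₁, max_eq_left h.le]
      exact (Real.log_le_log (by linarith) ht.le).trans hX
  have hlogn : Real.log t₁ ^ n ≤ W ^ n :=
    pow_le_pow_left₀ (Real.log_nonneg (by linarith)) hlog n
  obtain ⟨S, hS, hsep, hcard⟩ := hAC t₁ (W ^ n) (hWt.trans (hWV.trans ht₁V)) hlogn ht₁V
  have hKc : K ≤ S.card := by exact_mod_cast hK.trans hcard
  have hball := zeros_ball_of_window ht₁u ht₁le ht₁V (by linarith) S hS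
  rcases le_or_gt 0 t with h0 | h0
  · rw [abs_of_nonneg h0] at hball
    exact ⟨S, hball, hsep, hKc⟩
  · rw [abs_of_neg h0] at hball
    obtain ⟨h1, h2, h3⟩ := zeros_ball_reflect S hball hsep
    rw [neg_neg] at h1
    exact ⟨S.image (fun x : ℝ ↦ -x), h1, h2, hKc.trans h3.ge⟩

set_option maxHeartbeats 400000 in
/-- **T68. RH + windowed anti-clustering of the zeros ⟹ the double-exponential lower law.**
Under RH and (AC*) — every window `[t, t + V]`, `t ≥ t*`, `(log t)^n ≤ V ≤ t`, holds `≥ c V log V`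
ordinates of zeros of `ζ` pairwise `≥ e^{-V}` apart (`c > 0`, `n ≥ 1`) — there is `A > 0` with
`Re Q(g) ≥ exp(-exp(A a))` for every unit Weil test `g` on `[-a, a]`, `a ≥ 1`. With the upper law
T2 (`exp(-c' e^{2a})`): `2a - O(1) ≤ log log(1/ε(a)) ≤ A a`.
[cite: Bombieri2000Weil, §4] [cite: Radziwill2012, Lemma 5] -/
theorem weilQuadratic_re_ge_exp_neg_exp_of_anticlustering (hRH : RiemannHypothesis)
    {c tstar : ℝ} {n : ℕ} (hc : 0 < c) (hn : 1 ≤ n)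
    (hAC : ∀ t V : ℝ, tstar ≤ t → Real.log t ^ n ≤ V → V ≤ t → ∃ S : Finset ℝ,
      (∀ γ ∈ S, t ≤ γ ∧ γ ≤ t + V ∧ riemannZeta (1 / 2 + γ * I) = 0) ∧
      (∀ γ ∈ S, ∀ γ' ∈ S, γ ≠ γ' → Real.exp (-V) ≤ |γ - γ'|) ∧ c * V * Real.log V ≤ S.card) :
    ∃ A : ℝ, 0 < A ∧ ∀ a : ℝ, 1 ≤ a → ∀ g : ℝ → ℂ, IsWeilTest g → tsupport g ⊆ Icc (-a) a →
      ∫ t, ‖g t‖ ^ 2 = (1 : ℝ) → Real.exp (-Real.exp (A * a)) ≤ (weilQuadratic g).re := by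
  obtain ⟨C₀, hC₀, hlaw⟩ := weilQuadratic_re_ge_of_zeros_near_every_height hRH
  have hn1 : (1 : ℝ) ≤ n := by exact_mod_cast hn
  obtain ⟨B, hB⟩ : ∃ B : ℝ, B = C₀ + 4 * n ^ 2 + |tstar| + 2 := ⟨_, rfl⟩
  have hB1 : 1 ≤ B := by rw [hB]; linarith [abs_nonneg tstar, sq_nonneg (n : ℝ)]
  have hB0 : 0 < B := by linarith
  refine ⟨496 * B ^ (2 * n) + 1 + 2 * n * (2 + 19 / c), by positivity,
    fun a ha g hg hsupp hnorm ↦ ?_⟩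
  have ha0 : 0 < a := by linarith
  -- the scales `Y = C₀ a e^a` (log of the ceiling), `W`, `V = W^n`
  obtain ⟨Y, hY⟩ : ∃ Y : ℝ, Y = C₀ * a * Real.exp a := ⟨_, rfl⟩
  have hY0 : 0 < Y := by rw [hY]; positivity
  obtain ⟨W, hW⟩ : ∃ W : ℝ, W = Y + 4 * n ^ 2 + |tstar| + Real.exp (19 * a / c) + a := ⟨_, rfl⟩
  have hts := abs_nonneg tstar
  have hts' := le_abs_self tstar
  have he19 := Real.exp_pos (19 * a / c)
  have hn2 : (0 : ℝ) ≤ 4 * n ^ 2 := by positivity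
  have hWY : Y ≤ W := by rw [hW]; linarith
  have hWa : a ≤ W := by rw [hW]; linarith
  have hW1 : 1 ≤ W := ha.trans hWa
  have hWn : 4 * (n : ℝ) ^ 2 ≤ W := by rw [hW]; linarith
  have hWt : tstar ≤ W := by rw [hW]; linarith
  have hWe : Real.exp (19 * a / c) ≤ W := by rw [hW]; linarith
  obtain ⟨V, hV⟩ : ∃ V : ℝ, V = W ^ n := ⟨_, rfl⟩
  have hWV : W ≤ V := by rw [hV]; exact le_self_pow₀ hW1 (by omega)
  have hV1 : 1 ≤ V := hW1.trans hWV
  have hV0 : 0 < V := by linarith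
  have hYV : Y ≤ V := hWY.trans hWV
  have haV : a ≤ V := hWa.trans hWV
  have hclogV : 19 * a ≤ c * Real.log V := by
    have h1 : Real.log (Real.exp (19 * a / c)) ≤ Real.log V :=
      Real.log_le_log (Real.exp_pos _) (hWe.trans hWV)
    rw [Real.log_exp] at h1
    have h2 := mul_le_mul_of_nonneg_left h1 hc.le
    have h3 : c * (19 * a / c) = 19 * a := by field_simp
    linarith
  -- the node count `K`
  have hlog2 : 0 < Real.log 2 := Real.log_pos one_lt_two
  obtain ⟨L, hL⟩ : ∃ L : ℝ, L = Real.log 2 + 6 * V * a + a + Y := ⟨_, rfl⟩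
  have hVa0 : 0 < V * a := mul_pos hV0 ha0
  have hL0 : 0 < L := by rw [hL]; linarith
  obtain ⟨K, hK⟩ : ∃ K : ℕ, K = ⌈L / Real.log 2⌉₊ := ⟨_, rfl⟩
  have hKL : L ≤ K * Real.log 2 := by
    have h := Nat.le_ceil (L / Real.log 2)
    rw [← hK] at h
    rwa [div_le_iff₀ hlog2] at h
  have hKle : (K : ℝ) ≤ 19 * V * a := by
    have h := Nat.ceil_lt_add_one (div_nonneg hL0.le hlog2.le)
    rw [← hK] at h
    have hl : L / Real.log 2 ≤ 2 * L := by
      rw [div_le_iff₀ hlog2]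
      have hm := mul_le_mul_of_nonneg_left Real.log_two_gt_d9.le hL0.le
      linarith
    have hlog2' : Real.log 2 ≤ 1 := by
      have := Real.log_two_lt_d9
      linarith
    have hVa : V ≤ V * a := le_mul_of_one_le_right hV0.le ha
    have hVa1 : 1 ≤ V * a := hV1.trans hVa
    linarith
  have hK1 : 1 ≤ K := by
    by_contra h
    push Not at h
    have h0 : K = 0 := by omega
    rw [h0, Nat.cast_zero, zero_mul] at hKL
    linarith
  have hK1' : (1 : ℝ) ≤ K := by exact_mod_cast hK1
  -- T67's growth condition at radius `2V`
  have hgrowth : 2 * Real.exp (3 * (2 * V) * a) * Real.sqrt (2 * a) *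
      Real.exp (C₀ * a * Real.exp a) ≤ 2 ^ K := by
    rw [PrimeReciprocal.two_pow_eq_exp, ← hY]
    calc 2 * Real.exp (3 * (2 * V) * a) * Real.sqrt (2 * a) * Real.exp Y
        ≤ 2 * Real.exp (3 * (2 * V) * a) * Real.exp a * Real.exp Y := by
          gcongr
          exact sqrt_two_mul_le_exp a
      _ = Real.exp L := by
          rw [hL, show Real.log 2 + 6 * V * a + a + Y = Real.log 2 + 3 * (2 * V) * a + a + Y by
            ring, Real.exp_add, Real.exp_add, Real.exp_add, Real.exp_log two_pos]
      _ ≤ Real.exp (K * Real.log 2) := Real.exp_le_exp.2 hKL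
  -- the zeros near every height, from (AC*)
  have hKc : (K : ℝ) ≤ c * W ^ n * Real.log (W ^ n) := by
    rw [← hV]
    have h := mul_le_mul_of_nonneg_left hclogV hV0.le
    linarith
  have hX : Real.log (Real.exp Y) ≤ W := by rw [Real.log_exp]; exact hWY
  have hwin := zeros_near_every_height_of_windows hn hAC hW1 hWn hWt hX hKc
  rw [← hV, hY] at hwin
  have key := hlaw a ha (2 * V) (Real.exp (-V)) (by linarith) (Real.exp_pos _) K hgrowth hwin
    g hg hsupp hnorm
  rw [← hY] at key
  refine le_trans (le_min ?_ ?_) key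
  · rw [Real.exp_le_one_iff]
    linarith [(Real.exp_pos (((496 * B ^ (2 * n) + 1 + 2 * n * (2 + 19 / c))) * a))]
  -- the numeric lower bound `exp(-exp(A a)) ≤ exp(-496 a V²) ≤ (…)² (…)²`
  have hK0 : (0 : ℝ) < 4 * K := by linarith
  have hf1 : Real.exp (-(Y + 4 * K)) ≤ Real.exp (-Y) / (4 * K) := by
    rw [neg_add, Real.exp_add, div_eq_mul_one_div]
    exact mul_le_mul_of_nonneg_left (Tao2016.exp_neg_le_inv hK0) (Real.exp_pos _).le
  have hf2 : Real.exp (-(9 * V)) ≤ Real.exp (-V) / (4 * (2 * V)) := by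
    rw [show -(9 * V) = -V + -(8 * V) by ring, Real.exp_add, div_eq_mul_one_div,
      show 4 * (2 * V) = 8 * V by ring]
    exact mul_le_mul_of_nonneg_left (Tao2016.exp_neg_le_inv (by linarith)) (Real.exp_pos _).le
  have hf2pow : Real.exp (-(9 * V * K)) ≤ (Real.exp (-V) / (4 * (2 * V))) ^ (K - 1) := by
    have hcast : ((K - 1 : ℕ) : ℝ) = K - 1 := by
      rw [Nat.cast_sub hK1, Nat.cast_one]
    calc Real.exp (-(9 * V * K)) ≤ Real.exp ((K - 1 : ℕ) * (-(9 * V))) := by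
          rw [Real.exp_le_exp, hcast]
          linarith
      _ = Real.exp (-(9 * V)) ^ (K - 1) := Real.exp_nat_mul _ _
      _ ≤ (Real.exp (-V) / (4 * (2 * V))) ^ (K - 1) :=
          pow_le_pow_left₀ (Real.exp_pos _).le hf2 _
  have hprod : Real.exp (-(496 * a * V ^ 2)) ≤ (Real.exp (-Y) / (4 * K)) ^ 2 *
      ((Real.exp (-V) / (4 * (2 * V))) ^ (K - 1)) ^ 2 := by
    have hVa2 : V * a ≤ a * V ^ 2 := by
      have h := mul_le_mul_of_nonneg_left hV1 hVa0.le
      calc V * a = V * a * 1 := (mul_one _).symm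
        _ ≤ V * a * V := h
        _ = a * V ^ 2 := by ring
    have hV2 : V ≤ a * V ^ 2 := (le_mul_of_one_le_right hV0.le ha).trans hVa2
    have hVK : V * K ≤ V * (19 * V * a) := mul_le_mul_of_nonneg_left hKle hV0.le
    calc Real.exp (-(496 * a * V ^ 2))
        ≤ Real.exp ((-(Y + 4 * K) + -(9 * V * K)) + (-(Y + 4 * K) + -(9 * V * K))) := by
          rw [Real.exp_le_exp]
          linarith
      _ = (Real.exp (-(Y + 4 * K)) * Real.exp (-(9 * V * K))) ^ 2 := by
          rw [sq, ← Real.exp_add, ← Real.exp_add]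
      _ ≤ (Real.exp (-Y) / (4 * K) * (Real.exp (-V) / (4 * (2 * V))) ^ (K - 1)) ^ 2 :=
          pow_le_pow_left₀ (by positivity) (mul_le_mul hf1 hf2pow (Real.exp_pos _).le
            (div_nonneg (Real.exp_pos _).le hK0.le)) 2
      _ = (Real.exp (-Y) / (4 * K)) ^ 2 * ((Real.exp (-V) / (4 * (2 * V))) ^ (K - 1)) ^ 2 := by
          rw [mul_pow]
  refine le_trans ?_ hprod
  -- `496 a V² ≤ exp(A a)`
  rw [Real.exp_le_exp, neg_le_neg_iff]
  obtain ⟨E, hE⟩ : ∃ E : ℝ, E = Real.exp ((2 + 19 / c) * a) := ⟨_, rfl⟩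
  have hE1 : 1 ≤ E := by rw [hE]; exact Real.one_le_exp (by positivity)
  have hE0 : 0 < E := by linarith
  have haexp : a ≤ Real.exp a := by linarith [Real.add_one_le_exp a]
  have hWle : W ≤ B * E := by
    have h1 : Y ≤ C₀ * E := by
      rw [hY, hE, mul_assoc]
      refine mul_le_mul_of_nonneg_left ?_ hC₀.le
      calc a * Real.exp a ≤ Real.exp a * Real.exp a :=
            mul_le_mul_of_nonneg_right haexp (Real.exp_pos a).le
        _ = Real.exp ((1 + 1) * a) := by rw [← Real.exp_add]; ring_nf
        _ ≤ Real.exp ((2 + 19 / c) * a) := by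
            rw [Real.exp_le_exp]
            have : 0 ≤ 19 / c * a := by positivity
            linarith
    have h2 : Real.exp (19 * a / c) ≤ E := by
      rw [hE, Real.exp_le_exp]
      have : 19 * a / c = 19 / c * a := by ring
      linarith
    have h3 : a ≤ E := by
      calc a ≤ Real.exp a := haexp
        _ ≤ E := by
          rw [hE, Real.exp_le_exp]
          have : 0 ≤ 19 / c * a := by positivity
          linarith
    have h4 : 4 * (n : ℝ) ^ 2 ≤ 4 * n ^ 2 * E := le_mul_of_one_le_right hn2 hE1
    have h5 : |tstar| ≤ |tstar| * E := le_mul_of_one_le_right hts hE1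
    rw [hW, hB]
    linarith
  have hW0 : 0 ≤ W := by linarith
  have hV2le : V ^ 2 ≤ B ^ (2 * n) * Real.exp ((2 * n * (2 + 19 / c)) * a) := by
    calc V ^ 2 = W ^ (2 * n) := by rw [hV, ← pow_mul, mul_comm]
      _ ≤ (B * E) ^ (2 * n) := pow_le_pow_left₀ hW0 hWle _
      _ = B ^ (2 * n) * E ^ (2 * n) := mul_pow _ _ _
      _ = B ^ (2 * n) * Real.exp ((2 * n * (2 + 19 / c)) * a) := by
          rw [hE, ← Real.exp_nat_mul]
          push_cast
          ring_nf
  have hB2 : 0 < B ^ (2 * n) := by positivity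
  have h496 : 496 * B ^ (2 * n) ≤ Real.exp (496 * B ^ (2 * n) * a) := by
    calc 496 * B ^ (2 * n) ≤ 496 * B ^ (2 * n) * a := le_mul_of_one_le_right (by positivity) ha
      _ ≤ Real.exp (496 * B ^ (2 * n) * a) := by
          linarith [Real.add_one_le_exp (496 * B ^ (2 * n) * a)]
  calc 496 * a * V ^ 2
      ≤ 496 * a * (B ^ (2 * n) * Real.exp ((2 * n * (2 + 19 / c)) * a)) :=
        mul_le_mul_of_nonneg_left hV2le (by positivity)
    _ = (496 * B ^ (2 * n)) * a * Real.exp ((2 * n * (2 + 19 / c)) * a) := by ring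
    _ ≤ Real.exp (496 * B ^ (2 * n) * a) * Real.exp a *
          Real.exp ((2 * n * (2 + 19 / c)) * a) := by
        gcongr
    _ = Real.exp ((496 * B ^ (2 * n) + 1 + 2 * n * (2 + 19 / c)) * a) := by
        rw [← Real.exp_add, ← Real.exp_add]
        ring_nf

end Summit.RiemannHypothesis.RiemannHypothesis.Theorems
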